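import Mathlib
import HarnessLib
import Summits.KontsevichZagierPeriods.Zeta5Search.CatalanTwoAdicPFPoly

/-!
# CatalanTwoAdicPFProof — (L2) the partial-fraction identity `PF n J` of the slid Catalan-ray forms, PROVED

HONEST FRAMING: systematic search; no irrationality claim unless certified.  Pure algebra (a polynomial identity over
`ℚ` and its evaluation at half-integers); the irrationality consequence for `ξ = CatalanTwoAdicSeries.xi` (numerically
Calegari's `ζ₂(2)`, whose irrationality is KNOWN — Calegari 2005) is drawn in `CatalanTwoAdicFinal`; nothing about `G`.

fam-catalan (pub-zeta5), Lean file #17.  **`PF_holds (n J) (hJ : n ≤ J) : PF n J`** — the hypothesis of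
`CatalanTwoAdicPF.J2_eq_of_PF` (fam-denom CATK6 §1: `R_n(ν+½) = Σ_c A_c/(ν+½−c) + Σ_{a≤n}[B_a/(ν+½+a)² +
B_aΛ_a/(ν+½+a)] + Σ_{n<a≤2n} A_{−a}/(ν+½+a)` with fam-denom's `coef`, `logDer` BY NAME) — hence
**`PF_ray (j n) (hj : 1 ≤ j) : PF n (jn)`**, i.e. fam-catalan's node `RayPF j` for every `j ≥ 1`.
PROOF (Hermite interpolation, no analysis): let `P = K0·N − PFpoly` where `PFpoly` is the right-hand side cleared of
denominators (`Σ coef·D̂ + Σ coef·logDer·(X + a)·D̂`, `D̂_d = D₁D₂/(X − d)^{m_d}` the punctured denominators of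
`CatalanTwoAdicPFPoly`; first the two logarithmic derivatives `N′(−a) = N(−a)·Σ(−a−J+½+i)⁻¹` and
`D̂′_{−a}(−a) = D̂_{−a}(−a)·(Σ(−a−J+n+i)⁻¹ + Σ(−a+e+1)⁻¹)`, own factors contributing `0⁻¹ = 0`).  Then
`deg P ≤ J + 2n` (`natDegree_Pdiff_le`); `P` vanishes at every node (`Pdiff_eval_natCast`, `Pdiff_eval_neg`: at a
node only the own summand of `PFpoly` survives and equals `coef·D1·D2 = K0·N` by the DEFINITION of fam-denom's
`coef`); `P′` vanishes at every double node (`Pdiff_derivative_eval_neg`: the own summands give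
`K0·N(−a)·(Σ_{D̂} + logDer)` and `logDer = Σ_N − Σ_{D̂}` is fam-denom's DEFINITION, own factors entering as `0⁻¹ = 0`);
so the node polynomial `∏_c (X − c) · ∏_{a≤n} (X + a)² · ∏_{n<a≤2n} (X + a)` of degree `J + 2n + 1` divides `P`
(`nodePoly_dvd_Pdiff`, pairwise coprimality), forcing `P = 0` (`Pdiff_eq_zero`).  Evaluating at `T = ν + ½` (never a
node) and dividing by `D₁(T)D₂(T) ≠ 0` gives `PF n J` (`PF_holds`).
-/

namespace Summit.KontsevichZagierPeriods.Zeta5Search.CatalanTwoAdicSeries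

open Finset Polynomial
open Summit.KontsevichZagierPeriods.Zeta5Search.Denom.CatalanRayPClosed (K0 Nnum coef logDer D1 D2 skip)

/-! ### Logarithmic derivatives at a double node -/

/-- `N′(−a) = N(−a) · Σ_i (−a − J + ½ + i)⁻¹` (no factor of `N` vanishes at an integer). -/
theorem Npoly_derivative_eval_int (n J : ℕ) (z : ℤ) :
    (Npoly n J).derivative.eval (z : ℚ) = Nnum n J z * ∑ i ∈ range (J + n), ((z : ℚ) - J + 1 / 2 + i)⁻¹ := by
  have hne : ∀ i ∈ range (J + n), (X + C ((1 : ℚ) / 2 + i - J)).eval (z : ℚ) ≠ 0 := by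
    intro i _
    have h := Summit.KontsevichZagierPeriods.Zeta5Search.CatalanQSum.intCast_add_half_ne_zero (z + i - J)
    simp only [eval_add, eval_X, eval_C]
    push_cast at h
    intro h0; exact h (by linarith)
  unfold Npoly
  rw [derivative_prod_eval _ _ _ hne, ← Npoly, Npoly_eval]
  congr 1
  refine sum_congr rfl fun i hi => ?_
  have h := hne i hi
  simp only [eval_add, eval_X, eval_C] at h
  simp only [derivative_add, derivative_X, derivative_C, add_zero, eval_one, eval_add, eval_X, eval_C]
  rw [one_div, show (z : ℚ) + (1 / 2 + i - J) = z - J + 1 / 2 + i by ring]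

/-- `D̂_{−a}′(−a) = D̂_{−a}(−a) · (Σ_i (−a − J + n + i)⁻¹ + Σ_e (−a + e + 1)⁻¹)` (own factors contribute `0⁻¹ = 0`). -/
theorem Dhat_derivative_eval_self (n J : ℕ) (d : ℚ) :
    (Dhat n J d).derivative.eval d = (Dhat n J d).eval d *
      ((∑ i ∈ range (J + 1), (d - J + n + i)⁻¹) + ∑ e ∈ range (2 * n), (d + e + 1)⁻¹) := by
  have h1 : (D1hat n J d).derivative.eval d = (D1hat n J d).eval d * ∑ i ∈ range (J + 1), (d - J + n + i)⁻¹ := by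
    unfold D1hat
    rw [derivative_prod_eval _ _ _ (fun i _ => ite_eval_ne_zero (fun i : ℕ => d - J + n + i)
      (fun i : ℕ => (n : ℚ) + i - J) d i (by ring))]
    congr 1
    exact sum_congr rfl fun i _ => ite_derivative_div_eval (fun i : ℕ => d - J + n + i) (fun i : ℕ => (n : ℚ) + i - J)
      d i (by ring)
  have h2 : (D2hat n d).derivative.eval d = (D2hat n d).eval d * ∑ e ∈ range (2 * n), (d + e + 1)⁻¹ := by
    unfold D2hat
    rw [derivative_prod_eval _ _ _ (fun e _ => ite_eval_ne_zero (fun e : ℕ => d + e + 1)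
      (fun e : ℕ => (e : ℚ) + 1) d e (by ring))]
    congr 1
    exact sum_congr rfl fun e _ => ite_derivative_div_eval (fun e : ℕ => d + e + 1) (fun e : ℕ => (e : ℚ) + 1)
      d e (by ring)
  unfold Dhat
  rw [derivative_mul, eval_add, eval_mul, eval_mul, h1, h2, eval_mul]
  ring

/-! ### The cleared partial-fraction polynomial and the difference `P = K0·N − PFpoly` -/

/-- the right-hand side of `PF n J` multiplied by the full denominator `D = Dfull1·Dfull2`:
`Σ_c A_c D̂_c + Σ_{a≤n} [B_a D̂_{−a} + B_aΛ_a (X + a) D̂_{−a}] + Σ_{n<a≤2n} A_{−a} D̂_{−a}`. -/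
noncomputable def PFpoly (n J : ℕ) : ℚ[X] :=
  (∑ c ∈ range (J - n + 1), C (coef n J c) * Dhat n J c)
    + (∑ a ∈ Icc 1 n, (C (coef n J (-(a : ℚ))) * Dhat n J (-(a : ℚ))
        + C (coef n J (-(a : ℚ)) * logDer n J (-(a : ℚ))) * ((X - C (-(a : ℚ))) * Dhat n J (-(a : ℚ)))))
    + ∑ a ∈ Icc (n + 1) (2 * n), C (coef n J (-(a : ℚ))) * Dhat n J (-(a : ℚ))

/-- the difference polynomial `K0·N(X) − PFpoly(X)`; `PF n J` says it vanishes (at the half-integers). -/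
noncomputable def Pdiff (n J : ℕ) : ℚ[X] := C (K0 n) * Npoly n J - PFpoly n J

/-! ### Hermite data, I: `P` vanishes at every node -/

/-- `PFpoly(c) = A_c · D1(c)D2(c)` at a node `c ∈ [0, J−n]` (all other summands vanish there). -/
theorem PFpoly_eval_natCast {n J c : ℕ} (hJ : n ≤ J) (hc : c + n ≤ J) :
    (PFpoly n J).eval (c : ℚ) = coef n J c * (D1 n J c * D2 n c) := by
  have hneg : ∀ a : ℕ, 1 ≤ a → (Dhat n J (-(a : ℚ))).eval (c : ℚ) = 0 := fun a ha =>
    Dhat_eval_natCast_eq_zero hc (by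
      intro h; have : (a : ℚ) + c = 0 := by linarith
      have h2 : ((a + c : ℕ) : ℚ) = 0 := by push_cast; exact this
      have h3 : a + c = 0 := by exact_mod_cast h2
      omega)
  unfold PFpoly
  simp only [eval_add, eval_finsetSum, eval_mul, eval_C, eval_sub, eval_X]
  rw [sum_eq_single_of_mem c (mem_range.mpr (by omega)) (fun c' _ hc' => by
        rw [Dhat_eval_natCast_eq_zero hc (by exact_mod_cast hc'), mul_zero]),
    Dhat_eval_self,
    sum_eq_zero (fun a ha => by rw [hneg a (mem_Icc.mp ha).1]; ring),
    sum_eq_zero (fun a ha => by rw [hneg a (by have := (mem_Icc.mp ha).1; omega)]; ring)]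
  ring

/-- `PFpoly(−a) = coef(−a) · D1(−a)D2(−a)` at a node `−a`, `1 ≤ a ≤ 2n`. -/
theorem PFpoly_eval_neg {n J a : ℕ} (ha1 : 1 ≤ a) (ha2 : a ≤ 2 * n) :
    (PFpoly n J).eval (-(a : ℚ)) = coef n J (-(a : ℚ)) * (D1 n J (-(a : ℚ)) * D2 n (-(a : ℚ))) := by
  have hne : ∀ a' : ℕ, a' ≠ a → (Dhat n J (-(a' : ℚ))).eval (-(a : ℚ)) = 0 := fun a' ha' =>
    Dhat_eval_neg_eq_zero ha1 ha2 (by intro h; exact ha' (by exact_mod_cast neg_injective h))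
  have hpos : ∀ c : ℕ, (Dhat n J (c : ℚ)).eval (-(a : ℚ)) = 0 := fun c =>
    Dhat_eval_neg_eq_zero ha1 ha2 (by
      intro h; have h2 : ((a + c : ℕ) : ℚ) = 0 := by push_cast; linarith
      have h3 : a + c = 0 := by exact_mod_cast h2
      omega)
  unfold PFpoly
  simp only [eval_add, eval_finsetSum, eval_mul, eval_C, eval_sub, eval_X]
  rw [sum_eq_zero (fun c _ => by rw [hpos c, mul_zero]), zero_add]
  rcases le_or_gt a n with ha | ha
  · rw [sum_eq_single_of_mem a (mem_Icc.mpr ⟨ha1, ha⟩) (fun a' _ ha' => by rw [hne a' ha']; ring),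
      sum_eq_zero (fun a' ha' => by rw [hne a' (by have := (mem_Icc.mp ha').1; omega)]; ring),
      Dhat_eval_self]
    ring
  · rw [sum_eq_zero (fun a' ha' => by rw [hne a' (by have := (mem_Icc.mp ha').2; omega)]; ring),
      sum_eq_single_of_mem a (mem_Icc.mpr ⟨by omega, ha2⟩) (fun a' _ ha' => by rw [hne a' ha']; ring),
      Dhat_eval_self]
    ring

/-- `P(c) = 0` at the nodes `c ∈ [0, J−n]`. -/
theorem Pdiff_eval_natCast {n J c : ℕ} (hJ : n ≤ J) (hc : c + n ≤ J) : (Pdiff n J).eval (c : ℚ) = 0 := by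
  unfold Pdiff
  rw [eval_sub, eval_mul, eval_C, Npoly_eval, PFpoly_eval_natCast hJ hc, coef_mul_D1D2, sub_self]

/-- `P(−a) = 0` at the nodes `−a`, `1 ≤ a ≤ 2n`. -/
theorem Pdiff_eval_neg {n J a : ℕ} (ha1 : 1 ≤ a) (ha2 : a ≤ 2 * n) :
    (Pdiff n J).eval (-(a : ℚ)) = 0 := by
  unfold Pdiff
  rw [eval_sub, eval_mul, eval_C, Npoly_eval, PFpoly_eval_neg ha1 ha2, coef_mul_D1D2, sub_self]

/-! ### Hermite data, II: `P′` vanishes at every double node -/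

/-- `(k·p)′(t) = k·p′(t)`. -/
theorem derivative_C_mul_eval (k : ℚ) (p : ℚ[X]) (t : ℚ) :
    ((C k * p).derivative).eval t = k * p.derivative.eval t := by
  simp [derivative_mul]

/-- `PFpoly′(−a)` at a double node: only the two own summands survive. -/
theorem PFpoly_derivative_eval_neg {n J a : ℕ} (hJ : n ≤ J) (ha1 : 1 ≤ a) (ha : a ≤ n) :
    (PFpoly n J).derivative.eval (-(a : ℚ)) =
      coef n J (-(a : ℚ)) * (D1 n J (-(a : ℚ)) * D2 n (-(a : ℚ))) *
        (((∑ i ∈ range (J + 1), ((-(a : ℚ)) - J + n + i)⁻¹) + ∑ e ∈ range (2 * n), ((-(a : ℚ)) + e + 1)⁻¹)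
          + logDer n J (-(a : ℚ))) := by
  -- every other node's `D̂` is divisible by `(X + a)²`
  have hsq : ∀ d : ℚ, d ≠ -(a : ℚ) → (Dhat n J d).derivative.eval (-(a : ℚ)) = 0 := fun d hd =>
    derivative_eval_eq_zero_of_sq_dvd _ (sq_dvd_Dhat hJ ha1 ha hd)
  have hsq' : ∀ d : ℚ, d ≠ -(a : ℚ) → ((X - C d) * Dhat n J d).derivative.eval (-(a : ℚ)) = 0 := fun d hd =>
    derivative_eval_eq_zero_of_sq_dvd _ (dvd_mul_of_dvd_right (sq_dvd_Dhat hJ ha1 ha hd) _)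
  have hne : ∀ a' : ℕ, a' ≠ a → (-(a' : ℚ)) ≠ -(a : ℚ) := fun a' ha' h =>
    ha' (by exact_mod_cast neg_injective h)
  have hpos : ∀ c : ℕ, (c : ℚ) ≠ -(a : ℚ) := fun c h => by
    have h2 : ((a + c : ℕ) : ℚ) = 0 := by push_cast; linarith
    have h3 : a + c = 0 := by exact_mod_cast h2
    omega
  unfold PFpoly
  simp only [derivative_add, derivative_sum, eval_add, eval_finsetSum, derivative_C_mul_eval]
  rw [sum_eq_zero (s := range (J - n + 1)) (fun c _ => by rw [hsq _ (hpos c), mul_zero]), zero_add,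
    sum_eq_zero (s := Icc (n + 1) (2 * n))
      (fun a' ha' => by rw [hsq _ (hne a' (by have := (mem_Icc.mp ha').1; omega)), mul_zero]),
    add_zero,
    sum_eq_single_of_mem a (mem_Icc.mpr ⟨ha1, ha⟩) (fun a' _ ha' => by
      rw [hsq _ (hne a' ha'), hsq' _ (hne a' ha')]; ring),
    Dhat_derivative_eval_self, derivative_X_sub_C_mul_eval, Dhat_eval_self]
  ring

/-- `P′(−a) = 0` at the double nodes `−a`, `1 ≤ a ≤ n` — this is where fam-denom's `logDer` (with its
`0⁻¹ = 0` convention for the own factors) is exactly the logarithmic derivative of `(T + a)² R_n(T)` at `−a`. -/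
theorem Pdiff_derivative_eval_neg {n J a : ℕ} (hJ : n ≤ J) (ha1 : 1 ≤ a) (ha : a ≤ n) :
    (Pdiff n J).derivative.eval (-(a : ℚ)) = 0 := by
  have hN := Npoly_derivative_eval_int n J (-(a : ℤ))
  push_cast at hN
  have hV := coef_mul_D1D2 n J (-(a : ℚ))
  unfold Pdiff
  rw [derivative_sub, derivative_mul, derivative_C, zero_mul, zero_add, eval_sub, eval_mul, eval_C, hN,
    PFpoly_derivative_eval_neg hJ ha1 ha]
  unfold logDer
  linear_combination (-(∑ i ∈ range (J + n), ((-(a : ℚ)) - J + 1 / 2 + i)⁻¹)) * hV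

/-! ### Degree of `P` -/

/-- `deg PFpoly ≤ J + 2n`. -/
theorem natDegree_PFpoly_le {n J : ℕ} (hJ : n ≤ J) : (PFpoly n J).natDegree ≤ J + 2 * n := by
  unfold PFpoly
  refine (natDegree_add_le _ _).trans (max_le ((natDegree_add_le _ _).trans (max_le ?_ ?_)) ?_)
  · refine natDegree_sum_le_of_forall_le _ _ fun c hc => (natDegree_C_mul_le _ _).trans ?_
    exact natDegree_Dhat_natCast_le (by have := mem_range.mp hc; omega)
  · refine natDegree_sum_le_of_forall_le _ _ fun a ha => ?_
    obtain ⟨ha1, ha'⟩ := mem_Icc.mp ha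
    have hd := natDegree_Dhat_double_le (J := J) hJ ha1 ha'
    refine (natDegree_add_le _ _).trans (max_le ((natDegree_C_mul_le _ _).trans (hd.trans (by omega))) ?_)
    refine (natDegree_C_mul_le _ _).trans (natDegree_mul_le.trans ?_)
    rw [natDegree_X_sub_C]
    omega
  · refine natDegree_sum_le_of_forall_le _ _ fun a ha => (natDegree_C_mul_le _ _).trans ?_
    obtain ⟨ha1, ha2⟩ := mem_Icc.mp ha
    exact natDegree_Dhat_neg_le (by omega) ha2

/-- `deg P ≤ J + 2n`. -/
theorem natDegree_Pdiff_le {n J : ℕ} (hJ : n ≤ J) : (Pdiff n J).natDegree ≤ J + 2 * n := by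
  unfold Pdiff
  refine (natDegree_sub_le _ _).trans (max_le ((natDegree_C_mul_le _ _).trans ?_) (natDegree_PFpoly_le hJ))
  exact (natDegree_Npoly_le n J).trans (by omega)

/-! ### The node polynomial: degree `J + 2n + 1`, and it divides `P` -/

/-- `∏_c (X − c) · ∏_{a ≤ n} (X + a)² · ∏_{n < a ≤ 2n} (X + a)`. -/
noncomputable def nodePoly (n J : ℕ) : ℚ[X] :=
  (∏ c ∈ range (J - n + 1), (X - C (c : ℚ)))
    * ((∏ a ∈ Icc 1 n, (X - C (-(a : ℚ))) ^ 2) * ∏ a ∈ Icc (n + 1) (2 * n), (X - C (-(a : ℚ))))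

/-- the node polynomial has degree `J + 2n + 1` (nodes counted with multiplicity). -/
theorem natDegree_nodePoly {n J : ℕ} (hJ : n ≤ J) : (nodePoly n J).natDegree = J + 2 * n + 1 := by
  have h1 : (∏ c ∈ range (J - n + 1), (X - C (c : ℚ))).natDegree = J - n + 1 := by
    rw [natDegree_prod _ _ (fun c _ => X_sub_C_ne_zero _)]
    simp only [natDegree_X_sub_C, sum_const, card_range, smul_eq_mul, mul_one]
  have h2 : (∏ a ∈ Icc 1 n, (X - C (-(a : ℚ))) ^ 2).natDegree = 2 * n := by
    rw [natDegree_prod _ _ (fun a _ => pow_ne_zero _ (X_sub_C_ne_zero _))]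
    simp only [natDegree_pow, natDegree_X_sub_C, sum_const, Nat.card_Icc, smul_eq_mul, mul_one]
    omega
  have h3 : (∏ a ∈ Icc (n + 1) (2 * n), (X - C (-(a : ℚ)))).natDegree = n := by
    rw [natDegree_prod _ _ (fun a _ => X_sub_C_ne_zero _)]
    simp only [natDegree_X_sub_C, sum_const, Nat.card_Icc, smul_eq_mul, mul_one]
    omega
  have hz1 : (∏ c ∈ range (J - n + 1), (X - C (c : ℚ))) ≠ 0 := prod_ne_zero_iff.mpr fun c _ => X_sub_C_ne_zero _
  have hz2 : (∏ a ∈ Icc 1 n, (X - C (-(a : ℚ))) ^ 2) ≠ 0 :=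
    prod_ne_zero_iff.mpr fun a _ => pow_ne_zero _ (X_sub_C_ne_zero _)
  have hz3 : (∏ a ∈ Icc (n + 1) (2 * n), (X - C (-(a : ℚ)))) ≠ 0 :=
    prod_ne_zero_iff.mpr fun a _ => X_sub_C_ne_zero _
  unfold nodePoly
  rw [natDegree_mul hz1 (mul_ne_zero hz2 hz3), natDegree_mul hz2 hz3, h1, h2, h3]
  omega

/-- the node polynomial divides `P` (Hermite data + pairwise coprimality of the three node families). -/
theorem nodePoly_dvd_Pdiff {n J : ℕ} (hJ : n ≤ J) : nodePoly n J ∣ Pdiff n J := by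
  have hinjN : Function.Injective (fun c : ℕ => (c : ℚ)) := Nat.cast_injective
  have hinjA : Function.Injective (fun a : ℕ => -(a : ℚ)) := neg_injective.comp Nat.cast_injective
  have base : ∀ x y : ℚ, x ≠ y → IsCoprime (X - C x) (X - C y) := fun x y hxy =>
    pairwise_coprime_X_sub_C Function.injective_id hxy
  have hpos : ∀ c a : ℕ, 1 ≤ a → (c : ℚ) ≠ -(a : ℚ) := fun c a ha h => by
    have h2 : ((a + c : ℕ) : ℚ) = 0 := by push_cast; linarith
    have h3 : a + c = 0 := by exact_mod_cast h2
    omega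
  -- the three families divide
  have d1 : (∏ c ∈ range (J - n + 1), (X - C (c : ℚ))) ∣ Pdiff n J :=
    prod_dvd_of_coprime ((pairwise_coprime_X_sub_C hinjN).set_pairwise _) fun c hc =>
      dvd_iff_isRoot.mpr (Pdiff_eval_natCast hJ (by have := mem_range.mp hc; omega))
  have d2 : (∏ a ∈ Icc 1 n, (X - C (-(a : ℚ))) ^ 2) ∣ Pdiff n J :=
    prod_dvd_of_coprime (fun a _ b _ hab => ((pairwise_coprime_X_sub_C hinjA) hab).pow) fun a ha =>
      sq_dvd_of_eval_of_derivative_eval _ _ (Pdiff_eval_neg (mem_Icc.mp ha).1 (by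
        have := (mem_Icc.mp ha).2; omega)) (Pdiff_derivative_eval_neg hJ (mem_Icc.mp ha).1 (mem_Icc.mp ha).2)
  have d3 : (∏ a ∈ Icc (n + 1) (2 * n), (X - C (-(a : ℚ)))) ∣ Pdiff n J :=
    prod_dvd_of_coprime ((pairwise_coprime_X_sub_C hinjA).set_pairwise _) fun a ha =>
      dvd_iff_isRoot.mpr (Pdiff_eval_neg (by have := (mem_Icc.mp ha).1; omega) (mem_Icc.mp ha).2)
  -- pairwise coprimality of the families
  have c23 : IsCoprime (∏ a ∈ Icc 1 n, (X - C (-(a : ℚ))) ^ 2) (∏ a ∈ Icc (n + 1) (2 * n), (X - C (-(a : ℚ)))) :=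
    IsCoprime.prod_left fun a ha => IsCoprime.prod_right fun b hb => IsCoprime.pow_left (base _ _ (by
      have h1 := (mem_Icc.mp ha).2; have h2 := (mem_Icc.mp hb).1
      intro h; have : a = b := by exact_mod_cast neg_injective h
      omega))
  have c1 : IsCoprime (∏ c ∈ range (J - n + 1), (X - C (c : ℚ)))
      ((∏ a ∈ Icc 1 n, (X - C (-(a : ℚ))) ^ 2) * ∏ a ∈ Icc (n + 1) (2 * n), (X - C (-(a : ℚ)))) :=
    IsCoprime.prod_left fun c _ => IsCoprime.mul_right
      (IsCoprime.prod_right fun a ha => IsCoprime.pow_right (base _ _ (hpos c a (mem_Icc.mp ha).1)))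
      (IsCoprime.prod_right fun a ha => base _ _ (hpos c a (by have := (mem_Icc.mp ha).1; omega)))
  unfold nodePoly
  exact c1.mul_dvd d1 (c23.mul_dvd d2 d3)

/-- **The partial-fraction identity as a polynomial identity**: `K0·N(X) = PFpoly(X)` for `n ≤ J`. -/
theorem Pdiff_eq_zero {n J : ℕ} (hJ : n ≤ J) : Pdiff n J = 0 :=
  eq_zero_of_dvd_of_natDegree_lt (nodePoly_dvd_Pdiff hJ)
    (by rw [natDegree_nodePoly hJ]; exact Nat.lt_succ_of_le (natDegree_Pdiff_le hJ))

/-! ### From the polynomial identity to `PF n J` and `RayPF j` -/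

/-- the cleared identity, evaluated: `K0 · N(T) = PFpoly(T)` for every `T`. -/
theorem K0_mul_Nnum_eq_PFpoly_eval {n J : ℕ} (hJ : n ≤ J) (T : ℚ) :
    K0 n * Nnum n J T = (PFpoly n J).eval T := by
  have h := congrArg (eval T) (Pdiff_eq_zero hJ)
  rw [Pdiff, eval_sub, eval_zero, sub_eq_zero, eval_mul, eval_C, Npoly_eval] at h
  exact h

/-- the full denominator does not vanish at a half-integer. -/
theorem Dfull_half_ne_zero (n J ν : ℕ) :
    Dfull1 n J ((ν : ℚ) + 1 / 2) * Dfull2 n ((ν : ℚ) + 1 / 2) ≠ 0 := by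
  refine mul_ne_zero (prod_ne_zero_iff.mpr fun i _ => ?_) (prod_ne_zero_iff.mpr fun e _ => by positivity)
  have h := Summit.KontsevichZagierPeriods.Zeta5Search.CatalanQSum.intCast_add_half_ne_zero (ν - J + n + i)
  push_cast at h
  intro h0; exact h (by linarith)

/-- a half-integer minus an integer is non-zero. -/
theorem half_sub_ne_zero (ν : ℕ) (d : ℤ) : (ν : ℚ) + 1 / 2 - d ≠ 0 := by
  have h := Summit.KontsevichZagierPeriods.Zeta5Search.CatalanQSum.intCast_add_half_ne_zero (ν - d)
  push_cast at h
  intro h0; exact h (by linarith)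

/-- `(T − c) · D̂_c(T) = D(T)` for the nodes `c ∈ [0, J − n]`. -/
theorem Dhat_natCast_eval {n J c : ℕ} (hc : c + n ≤ J) (T : ℚ) :
    (T - c) * (Dhat n J c).eval T = Dfull1 n J T * Dfull2 n T := by
  have hp : (X - C (c : ℚ)) * Dhat n J c = D1poly n J * D2poly n := by
    unfold Dhat; rw [← mul_assoc, X_sub_C_mul_D1hat (poleC_D1 hc), D2hat_eq_D2poly (poleC_D2 n c)]
  have h := congrArg (eval T) hp
  simpa only [eval_mul, eval_sub, eval_X, eval_C, D1poly_eval, D2poly_eval] using h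

/-- `(T + a)² · D̂_{−a}(T) = D(T)` for the double nodes `1 ≤ a ≤ n`. -/
theorem Dhat_double_eval {n J a : ℕ} (hJ : n ≤ J) (ha1 : 1 ≤ a) (ha : a ≤ n) (T : ℚ) :
    (T + a) ^ 2 * (Dhat n J (-(a : ℚ))).eval T = Dfull1 n J T * Dfull2 n T := by
  have hp : (X - C (-(a : ℚ))) ^ 2 * Dhat n J (-(a : ℚ)) = D1poly n J * D2poly n := by
    unfold Dhat
    rw [show ∀ L A B : ℚ[X], L ^ 2 * (A * B) = (L * A) * (L * B) from fun L A B => by ring,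
      X_sub_C_mul_D1hat (poleA_D1_double hJ ha), X_sub_C_mul_D2hat (poleA_D2 ha1 (by omega))]
  have h := congrArg (eval T) hp
  simp only [eval_mul, eval_pow, eval_sub, eval_X, eval_C, D1poly_eval, D2poly_eval, sub_neg_eq_add] at h
  exact h

/-- `(T + a) · D̂_{−a}(T) = D(T)` for the simple nodes `n < a ≤ 2n`. -/
theorem Dhat_simple_eval {n J a : ℕ} (ha : n < a) (ha2 : a ≤ 2 * n) (T : ℚ) :
    (T + a) * (Dhat n J (-(a : ℚ))).eval T = Dfull1 n J T * Dfull2 n T := by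
  have hp : (X - C (-(a : ℚ))) * Dhat n J (-(a : ℚ)) = D1poly n J * D2poly n := by
    unfold Dhat
    rw [mul_left_comm, D1hat_eq_D1poly (poleA_D1_simple ha), X_sub_C_mul_D2hat (poleA_D2 (by omega) ha2)]
  have h := congrArg (eval T) hp
  simp only [eval_mul, eval_sub, eval_X, eval_C, D1poly_eval, D2poly_eval, sub_neg_eq_add] at h
  exact h

/-- **(L2) The partial-fraction identity `PF n J` holds for every `n ≤ J`.** -/
theorem PF_holds (n J : ℕ) (hJ : n ≤ J) : PF n J := by
  intro ν
  have hDD := Dfull_half_ne_zero n J ν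
  unfold Rn
  rw [K0_mul_Nnum_eq_PFpoly_eval hJ]
  unfold PFpoly
  simp only [eval_add, eval_finsetSum, eval_mul, eval_C, eval_sub, eval_X, sub_neg_eq_add]
  rw [add_div, add_div, sum_div, sum_div, sum_div]
  refine congrArg₂ (· + ·) (congrArg₂ (· + ·) (sum_congr rfl fun c hc => ?_) (sum_congr rfl fun a ha => ?_))
    (sum_congr rfl fun a ha => ?_)
  · have hc' : c + n ≤ J := by have := mem_range.mp hc; omega
    have hE := Dhat_natCast_eval hc' ((ν : ℚ) + 1 / 2)
    have hTc := half_sub_ne_zero ν c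
    push_cast at hTc
    rw [div_eq_div_iff hDD hTc, ← hE]
    ring
  · obtain ⟨ha1, ha'⟩ := mem_Icc.mp ha
    have hE := Dhat_double_eval hJ ha1 ha' ((ν : ℚ) + 1 / 2)
    have hTa := half_sub_ne_zero ν (-(a : ℤ))
    push_cast at hTa
    rw [sub_neg_eq_add] at hTa
    rw [div_add_div _ _ (pow_ne_zero 2 hTa) hTa, div_eq_div_iff hDD (mul_ne_zero (pow_ne_zero 2 hTa) hTa), ← hE]
    ring
  · obtain ⟨ha1, ha2⟩ := mem_Icc.mp ha
    have hE := Dhat_simple_eval (J := J) (by omega : n < a) ha2 ((ν : ℚ) + 1 / 2)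
    have hTa := half_sub_ne_zero ν (-(a : ℤ))
    push_cast at hTa
    rw [sub_neg_eq_add] at hTa
    rw [div_eq_div_iff hDD hTa, ← hE]
    ring

/-- **(L2 on the rays)** `PF n (jn)` for every `j ≥ 1` and every `n` — fam-catalan's node `RayPF j`
(`CatalanTwoAdicRayClosed`) for every `j ≥ 1`; the packaging as `RayPF j` is `CatalanTwoAdicFinal.rayPF_holds`. -/
theorem PF_ray (j n : ℕ) (hj : 1 ≤ j) : PF n (j * n) := PF_holds n (j * n) (Nat.le_mul_of_pos_left n hj)

end Summit.KontsevichZagierPeriods.Zeta5Search.CatalanTwoAdicSeries
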